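import Summits.BirchSwinnertonDyer.BirchSwinnertonDyer.Theorems.KatoDescentPotSupersingularKatoFiniteLevelStrictAdditiveInertia
import Summits.BirchSwinnertonDyer.Rank1Residual.X11b.BDPRouteLocalTorsionPurity
import Literature.NumberTheory.EllipticCurves.ReductionHomomorphismCuspNodeProofs
import Literature.NumberTheory.EllipticCurves.VariableChangePoints
import HarnessLib

/-!
# Kato's (14.9.3) at finite level, part 23: the NÉRON / TAMAGAWA reading at the ADDITIVE places —
# `#E(K_v)[p^∞] = p^{v_p(c_v)}` and `#H¹_ur(K_v, E[p^∞]) = p^{v_p(c_v)}` at every finite `v ∤ p` of additive reduction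
# (route `KatoDescentPotSupersingular` / `…Tame…`, crux M = stmt-BirchSwinnertonDyer-19196; route-free helper)

Seat `bsd-potss-rkm` g18 (prover; cell `bsd-potss`), item stmt-BirchSwinnertonDyer-19196 (`--supports … --as helper`; closes
nothing).  HONEST FRAMING: BSD is not proved by any of this; nothing is booked; theorems only (no definition, no named fact).

Item (δ) of the rkm g17 successor menu («Néron reading `#H¹_ur(ℚ_ℓ, E[p^∞]) = c_ℓ^{(p)}`», the Tamagawa term of Kato's
Prop. 14.16 (2) / §14.8: `S(T)/Sel(T) ↪ ⊕_{ℓ ≠ p} H¹(𝔽_ℓ, H⁰(ℚ_ℓ^{nr}, E[p^∞]))`) at the ADDITIVE places `v ∤ p`, as THEOREMS of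
the tree's Kodaira–Néron / reduction library:

* `primaryComponent_nonsingularReductionSubgroup_eq_bot_of_hasAdditiveReductionAt` — on the minimal `𝓞_v`-model `X` of `E` at
  an additive place `v ∤ p`, **`X₀(K_v)[p^∞] = 0`**: the reduction `r : X₀(K_v) → k̄_v⁺` of a cusp (Silverman *AEC* VII.2.1 with
  III.2.5, tree `exists_addMonoidHom_residueField_of_cusp`) kills `p`-power torsion (`char k_v ∤ p`), its kernel is
  `E₁(K_v)`, which has no `p`-torsion (VII.3.1, tree `LocalPurity.kernelOfReduction_torsionFree`);
* `natCard_primaryComponent_localMinimalIntegralModel_eq_pow_of_hasAdditiveReductionAt` — hence, by the purity count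
  `#X(K_v)[p^∞] = #X₀(K_v)[p^∞] · p^{v_p(c_v)}` (tree `LocalPurity.natCard_primaryComponent_point_eq_mul_pow_localTamagawaNumber`,
  Kodaira–Néron VII.6.1/6.2), **`#X(K_v)[p^∞] = p^{v_p(c_v)}`**;
* `natCard_primaryComponent_point_eq_pow_padicValNat_localTamagawaNumber_of_hasAdditiveReductionAt` — the same for the given
  equation `E ⊗ K_v` (a change of variables over `K_v`, `VariableChange.pointEquiv`): **`#E(K_v)[p^∞] = p^{v_p(c_v)}`**;
* `natCard_unramifiedSubgroup_primary_eq_pow_padicValNat_localTamagawaNumber_of_hasAdditiveReductionAt` — with part 22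
  (`#H¹_ur(K_v, E[p^∞]) = #E(K_v)[p^∞]` at additive `v ∤ p`): **`#H¹_ur(K_v, E[p^∞]) = p^{v_p(c_v)}`** — Kato's §14.8 / Greenberg's
  "`#ker r_v = c_v^{(p)}`" at every additive place `v ∤ p`, hypothesis-free.

The multiplicative places are NOT treated here (n1011's `InertiaDivisible*` / `InertiaRootableNonsplitMultiplicative` give
`H¹_ur(K_v, E[p^∞]) = 0` whenever `p ∤ c_v`; the split case `p ∣ ord_v Δ` remains).

References: J. H. Silverman, *AEC* VII.2.1, VII.3.1, Thm. VII.6.1, Cor. VII.6.2, III.2.5 [SilvermanAEC2009]; R. Greenberg, LNM 1716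
(1999) §3 Lemma 3.3, §4 proof of Thm. 4.1 (p. 74) [GreenbergLNM1716]; K. Kato, Astérisque 295 (2004) §14.8, Prop. 14.16 (2)
[Kato2004Asterisque]; J. S. Milne, *ADT* I Lemma 2.9 [MilneADT2006].
-/

-- the summit and its single problem are both named `BirchSwinnertonDyer` (registry layout D-0017)
set_option linter.dupNamespace false
set_option autoImplicit false

noncomputable section

open scoped Classical NumberField AddSubgroup NNReal
open Function Field NumberField IsDedekindDomain IsDedekindDomain.HeightOneSpectrum WeierstrassCurve
open Literature.NumberTheory.EllipticCurves Literature.NumberTheory.GaloisRepresentations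
  Literature.NumberTheory.GaloisRepresentations.DiscreteGaloisModule Literature.NumberTheory.GaloisCohomology
open Summit.BirchSwinnertonDyer.Rank1Residual.X11b.LocBridge
open Summit.BirchSwinnertonDyer.Rank1Residual.X11b

namespace Summit.BirchSwinnertonDyer.BirchSwinnertonDyer.Theorems.KatoFiniteLevelCount

/-! ## §0 Two elementary helpers -/

/-- An additive isomorphism preserves the order of the `p`-primary part. [folklore] -/
theorem natCard_primaryComponent_congr {A B : Type*} [AddCommGroup A] [AddCommGroup B] (p : ℕ) (e : A ≃+ B) :
    Nat.card (AddCommGroup.primaryComponent A p) = Nat.card (AddCommGroup.primaryComponent B p) := by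
  refine Nat.card_congr (e.toEquiv.subtypeEquiv fun a => ?_)
  simp only [AddCommGroup.mem_primaryComponent, AddEquiv.toEquiv_eq_coe, EquivLike.coe_coe]
  refine ⟨fun ⟨k, hk⟩ => ⟨k, by rw [← map_nsmul, hk, map_zero]⟩, fun ⟨k, hk⟩ => ⟨k, e.injective ?_⟩⟩
  rw [map_nsmul, hk, map_zero]

/-- In an additive group, an element killed by a power of `p` and lying in a subgroup all of whose elements killed by `p`
vanish is zero. [folklore] -/
theorem eq_zero_of_pow_nsmul_eq_zero_of_forall {A : Type*} [AddCommGroup A] {p : ℕ} (H : AddSubgroup A)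
    (hH : ∀ P ∈ H, p • P = 0 → P = 0) {P : A} (hP : P ∈ H) {n : ℕ} (hn : p ^ n • P = 0) : P = 0 := by
  induction n generalizing P with
  | zero => simpa using hn
  | succ n ih =>
    have h1 : p ^ n • (p • P) = 0 := by rw [← mul_smul, ← pow_succ, hn]
    have h2 : p • P = 0 := ih (H.nsmul_mem hP p) h1
    exact hH P hP h2

/-! ## §1 `X₀(K_v)[p^∞] = 0` and `#X(K_v)[p^∞] = p^{v_p(c_v)}` on the minimal model at an additive `v ∤ p` -/

section Additive

variable {K : Type} [Field K] [NumberField K] (W : WeierstrassCurve K) [W.IsElliptic] (p : ℕ) [Fact p.Prime]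
  (v : HeightOneSpectrum (𝓞 K))

omit [Fact p.Prime] in
/-- **`X₀(K_v)[p^∞] = 0` at an additive place `v ∤ p`** (`X` the minimal `𝓞_v`-model of `E` at `v`, `X₀(K_v)` its points of
nonsingular reduction): the cusp's reduction homomorphism `r : X₀(K_v) → k̄_v⁺` (kernel `E₁(K_v)`) kills every `p`-power-torsion
point because `(p : k̄_v) ≠ 0`, and `E₁(K_v)` has no `p`-torsion.
[cite: SilvermanAEC2009, Prop. VII.2.1, Prop. VII.3.1, Prop. III.2.5] -/
theorem primaryComponent_nonsingularReductionSubgroup_eq_bot_of_hasAdditiveReductionAt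
    (hpv : (p : 𝓞 K) ∉ v.asIdeal) (hadd : W.HasAdditiveReductionAt v) :
    AddCommGroup.primaryComponent
        ↥((W.localMinimalIntegralModel v).nonsingularReductionSubgroup
          (integers_valuationRing_valuation (v.adicCompletionIntegers K) (v.adicCompletion K))) p = ⊥ := by
  have hv0 := integers_valuationRing_valuation (v.adicCompletionIntegers K) (v.adicCompletion K)
  have hp : IsUnit ((p : ℕ) : v.adicCompletionIntegers K) := by
    have h := isUnit_algebraMap_adicCompletionIntegers K v hpv
    rwa [map_natCast] at h
  -- the reduction of the minimal model is a cusp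
  have hres : ∀ {a : v.adicCompletionIntegers K}, IsDedekindDomain.HeightOneSpectrum.valuation (v.adicCompletion K)
      (IsDiscreteValuationRing.maximalIdeal (v.adicCompletionIntegers K))
        (algebraMap (v.adicCompletionIntegers K) (v.adicCompletion K) a) < 1 →
      IsLocalRing.residue (v.adicCompletionIntegers K) a = 0 := by
    intro a hlt
    exact (IsLocalRing.residue_eq_zero_iff a).mpr
      ((IsDedekindDomain.HeightOneSpectrum.valuation_lt_one_iff_mem _ a).mp hlt)
  have hΔ : IsLocalRing.residue (v.adicCompletionIntegers K) (W.localMinimalIntegralModel v).Δ = 0 := by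
    refine hres ?_
    change IsDedekindDomain.HeightOneSpectrum.valuation _ _ (algebraMap (v.adicCompletionIntegers K) (v.adicCompletion K)
      ((W.localMinimalModel v).integralModel (v.adicCompletionIntegers K)).Δ) < 1
    rw [integralModel_Δ_eq]
    exact hadd.badReduction
  have hc₄ : IsLocalRing.residue (v.adicCompletionIntegers K) (W.localMinimalIntegralModel v).c₄ = 0 := by
    refine hres ?_
    change IsDedekindDomain.HeightOneSpectrum.valuation _ _ (algebraMap (v.adicCompletionIntegers K) (v.adicCompletion K)
      ((W.localMinimalModel v).integralModel (v.adicCompletionIntegers K)).c₄) < 1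
    rw [integralModel_c₄_eq]
    exact hadd.additiveReduction
  obtain ⟨r, hr⟩ := (W.localMinimalIntegralModel v).exists_addMonoidHom_residueField_of_cusp hv0 hΔ hc₄
  -- `(p : k̄_v) ≠ 0`: `p` is a unit of `𝓞_v`, so its residue is non-zero, and `k_v → k̄_v` is injective
  have h1 : IsLocalRing.residue (v.adicCompletionIntegers K) ((p : ℕ) : v.adicCompletionIntegers K) ≠ 0 :=
    (hp.map (IsLocalRing.residue (v.adicCompletionIntegers K))).ne_zero
  have hpk : ((p : ℕ) : AlgebraicClosure (IsLocalRing.ResidueField (v.adicCompletionIntegers K))) ≠ 0 := by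
    have h2 := (_root_.map_ne_zero (algebraMap (IsLocalRing.ResidueField (v.adicCompletionIntegers K))
      (AlgebraicClosure (IsLocalRing.ResidueField (v.adicCompletionIntegers K))))).mpr h1
    simpa using h2
  rw [eq_bot_iff]
  intro P hP
  obtain ⟨n, hn⟩ := (AddCommGroup.mem_primaryComponent).mp hP
  -- `r P` is `p`-power torsion in a field of characteristic `≠ p`, hence `0`
  have hrP : r P = 0 := by
    have h := congrArg r hn
    rw [map_nsmul, map_zero, nsmul_eq_mul] at h
    rcases mul_eq_zero.mp h with h0 | h0
    · exact (pow_ne_zero n hpk (by exact_mod_cast h0)).elim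
    · exact h0
  -- so `P ∈ E₁(K_v)`, which has no `p`-torsion
  have hker : (P : ((W.localMinimalIntegralModel v).baseChange (v.adicCompletion K)).toAffine.Point) ∈
      (W.localMinimalIntegralModel v).kernelOfReduction hv0 :=
    (WeierstrassCurve.mem_kernelOfReduction_iff hv0).mpr ((hr P).mp hrP)
  have hn' : p ^ n • (P : ((W.localMinimalIntegralModel v).baseChange (v.adicCompletion K)).toAffine.Point) = 0 := by
    rw [← AddSubgroupClass.coe_nsmul, hn, ZeroMemClass.coe_zero]
  have hP0 := eq_zero_of_pow_nsmul_eq_zero_of_forall _ (LocalPurity.kernelOfReduction_torsionFree W v hp) hker hn'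
  rw [AddSubgroup.mem_bot]
  exact Subtype.ext hP0

/-- **`#X(K_v)[p^∞] = p^{v_p(c_v)}` on the minimal `𝓞_v`-model at an additive place `v ∤ p`** — the purity count
`#X(K_v)[p^∞] = #X₀(K_v)[p^∞] · p^{v_p(c_v)}` (Kodaira–Néron) with `X₀(K_v)[p^∞] = 0`.
[cite: SilvermanAEC2009, Thm. VII.6.1 and Cor. VII.6.2, Prop. VII.2.1, Prop. VII.3.1]
[cite: GreenbergLNM1716, §4 proof of Thm. 4.1 (p. 74)] -/
theorem natCard_primaryComponent_localMinimalIntegralModel_eq_pow_of_hasAdditiveReductionAt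
    (hpv : (p : 𝓞 K) ∉ v.asIdeal) (hadd : W.HasAdditiveReductionAt v) :
    Nat.card (AddCommGroup.primaryComponent
        ((W.localMinimalIntegralModel v).baseChange (v.adicCompletion K)).toAffine.Point p) =
      p ^ padicValNat p ((W.baseChange (v.adicCompletion K)).localTamagawaNumber (v.adicCompletionIntegers K)) := by
  obtain ⟨-, hcount⟩ := LocalPurity.natCard_primaryComponent_point_eq_mul_pow_localTamagawaNumber W v (p := p) hpv
  rw [hcount, primaryComponent_nonsingularReductionSubgroup_eq_bot_of_hasAdditiveReductionAt W p v hpv hadd]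
  simp

/-- **`#E(K_v)[p^∞] = p^{v_p(c_v)}` at an additive place `v ∤ p`**, for the `K_v`-points of the given equation `E ⊗ K_v`
(isomorphic to those of the minimal model by a change of variables over `K_v`, `VariableChange.pointEquiv`): at an additive
place the whole `p`-power torsion of `E(K_v)` maps isomorphically onto the `p`-part of the component group `E(K_v)/E₀(K_v)`.
[cite: SilvermanAEC2009, Thm. VII.6.1, Cor. VII.6.2, Prop. VII.2.1, Prop. VII.3.1] [cite: GreenbergLNM1716, §4 proof of Thm. 4.1 (p. 74)] -/
theorem natCard_primaryComponent_point_eq_pow_padicValNat_localTamagawaNumber_of_hasAdditiveReductionAt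
    (hpv : (p : 𝓞 K) ∉ v.asIdeal) (hadd : W.HasAdditiveReductionAt v) :
    Nat.card (AddCommGroup.primaryComponent (W.baseChange (v.adicCompletion K)).toAffine.Point p) =
      p ^ padicValNat p ((W.baseChange (v.adicCompletion K)).localTamagawaNumber (v.adicCompletionIntegers K)) := by
  obtain ⟨C, hC⟩ := W.exists_variableChange_smul_eq_localMinimalModel v
  have hX : (W.localMinimalIntegralModel v).baseChange (v.adicCompletion K) = C • W.baseChange (v.adicCompletion K) := by
    change ((W.localMinimalModel v).integralModel (v.adicCompletionIntegers K)).baseChange (v.adicCompletion K) = _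
    rw [baseChange_integralModel_eq]
    exact hC.symm
  let e : (W.baseChange (v.adicCompletion K)).toAffine.Point ≃+
      ((W.localMinimalIntegralModel v).baseChange (v.adicCompletion K)).toAffine.Point :=
    (VariableChange.pointEquiv (W.baseChange (v.adicCompletion K)) C).trans (Affine.Point.congrEquiv hX.symm)
  rw [natCard_primaryComponent_congr p e]
  exact natCard_primaryComponent_localMinimalIntegralModel_eq_pow_of_hasAdditiveReductionAt W p v hpv hadd

/-- **`#H¹_ur(K_v, E[p^∞]) = p^{v_p(c_v)}` at every finite place `v ∤ p` of ADDITIVE reduction** — Kato's §14.8 summand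
`H¹(𝔽_v, H⁰(K_v^{nr}, E[p^∞]))` has order the `p`-part of the Tamagawa number: part 22
(`#H¹_ur(K_v, E[p^∞]) = #E(K_v)[p^∞]`, Milne *ADT* I 2.9 with finite inertia invariants) and `#E(K_v)[p^∞] = p^{v_p(c_v)}`.
[cite: Kato2004Asterisque, §14.8 (p. 238)] [cite: GreenbergLNM1716, §4 proof of Thm. 4.1 (p. 74)] [cite: MilneADT2006, Ch. I, Lemma 2.9]
[cite: SilvermanAEC2009, Thm. VII.6.1, Prop. VII.2.1, Prop. VII.3.1] -/
theorem natCard_unramifiedSubgroup_primary_eq_pow_padicValNat_localTamagawaNumber_of_hasAdditiveReductionAt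
    (hpv : (p : 𝓞 K) ∉ v.asIdeal) (hadd : W.HasAdditiveReductionAt v) :
    Nat.card (unramifiedSubgroup (GaloisRep.toLocal v (primaryGaloisModule W p)) 1) =
      p ^ padicValNat p ((W.baseChange (v.adicCompletion K)).localTamagawaNumber (v.adicCompletionIntegers K)) := by
  rw [natCard_unramifiedSubgroup_primary_eq_natCard_primaryComponent_of_hasAdditiveReductionAt W p v hpv hadd]
  exact natCard_primaryComponent_point_eq_pow_padicValNat_localTamagawaNumber_of_hasAdditiveReductionAt W p v hpv hadd

end Additive

end Summit.BirchSwinnertonDyer.BirchSwinnertonDyer.Theorems.KatoFiniteLevelCount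

end
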